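import Literature.Probability.Percolation.IsoradialRectangularCrossingsSSProofs
import Literature.Probability.Percolation.LoopRepresentationUniversality
import Literature.Probability.Percolation.QuadCrossingSpaceZ2
import HarnessLib

/-!
# DKKMO, Theorem 2.1 (`d_SS` half, `q = 1`): the horizontal symmetry `α ↦ π − α`

Proofs-only companion of `IsoradialRectangularCrossingsSS.lean` (the named fact
`DKKMO2020_thm21_schrammSmirnov`, Duminil-Copin–Kozlowski–Krachun–Manolescu–Oulamara,
arXiv:2012.11672v1, Theorem 2.1 at `q = 1`, Schramm–Smirnov half) and of
`IsoradialRectangularCrossingsSSProofs.lean` (its reduction to couplings agreeing on finitely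
many quads and to the printed Theorem 1.7 plus a loops-to-crossings transfer). No definition, no
named fact.

The printed proof of the universality theorem among the lattices `𝕃(α)` (arXiv:2012.11672v2,
§4.2) begins: "Define the set `R = {α ∈ (0, π) : φ_{𝕃(α)}` asymptotically similar to
`φ_{𝕃(π/2)}}`. [...] **by horizontal symmetry, `R` is stable by `α ↦ π − α`.**" On the loop side
(`d_CN`) this symmetry is `cnLawEDist_isoRect_pi_sub_pi_div_two` /
`dkkmo_theorem_1_7_iff_le_pi_div_two` (`LoopRepresentationUniversality.lean`). This file proves
the same symmetry ON THE SCHRAMM–SMIRNOV SIDE, exactly and configuration by configuration: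

* `isoRectDrawing_pi_sub_swapSite` — the lattice map `swapSite : (m, n) ↦ (-n, -m)` of `ℤ²` is
  realised on the drawn lattices by the reflection `S_0` in the real axis:
  `𝕃(π − α)(swapSite x) = S_0(𝕃(α) x)` (from `isoRectLinear_pi_sub_swap`).
* `openEdgeRealization_isoRectDrawing_pi_sub_image_swapPerm` — hence the open edges of
  `swapSite(ω)` drawn on `δ𝕃(π − α)` are the mirror image of the open edges of `ω` drawn on
  `δ𝕃(α)`.
* `isoRectQuadConfig_pi_sub_image_swapPerm` — **`S^{π−α}_{δ}(swapSite ω) = S_0 · S^{α}_{δ}(ω)`**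
  in Schramm–Smirnov's space `ℋ_ℂ` (`QuadConfig.mapHomeomorph`, transport of `S_ω` along a
  plane homeomorphism, `configOf_eq_mapHomeomorph`).
* `prodBernoulli_isoRectCriticalProb_map_image_swapPerm` — `swapSite` carries `φ_{δ𝕃(α)}` to
  `φ_{δ𝕃(π−α)}` (the weights of `𝕃(π − α)` are those of `𝕃(α)` with horizontal and vertical
  edges exchanged; `isoRectPercolation_map_swapSite_pi_sub`), and fixes `φ_{δ𝕃(π/2)}`.
* `coupling_image_swapPerm` — push-forward of a coupling of `φ_{δ𝕃(α)}`, `φ_{δ𝕃(π/2)}` under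
  `swapSite × swapSite`: a coupling of `φ_{δ𝕃(π−α)}`, `φ_{δ𝕃(π/2)}`, with the bad event
  transported; `DKKMO2020_thm21_schrammSmirnov.coupling_pi_sub` — the instance for the event
  "`(S^{α}, S^{π/2})` outside the mirrored neighbourhood `(S_0 × S_0)⁻¹ N`";
  `finiteQuads_coupling_pi_sub` — the instance for "the crossing indicators of some quad of the
  mirrored family `S_0⁻¹ F` disagree".
* `DKKMO2020_thm21_schrammSmirnov_iff_le_pi_div_two` — **the `d_SS` statement of Theorem 2.1
  is equivalent to its restriction to the acute angles `α ∈ (ε, π/2]`**: the obtuse angles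
  follow by the horizontal symmetry (the set of open neighbourhoods of the diagonal of
  `ℋ_ℂ × ℋ_ℂ` is stable under `S_0 × S_0`, `QuadConfig.continuous_mapHomeomorph`).
* `DKKMO2020_thm21_schrammSmirnov_iff_finiteQuads_le_pi_div_two` — combined with the reduction
  to finitely many quads (`DKKMO2020_thm21_schrammSmirnov_iff_finiteQuads`, Schramm–Smirnov's
  Lemma 5.1 discharged): **the fact is equivalent to the existence, for every finite family of
  quads, `ε > 0`, acute `α ∈ (ε, π/2]` and small mesh, of a coupling of `φ_{δ𝕃(α)}` and
  `φ_{δ𝕃(π/2)}` under which all the crossing indicators of the family agree off an event of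
  probability `< ε`** — the weakest interface left for the universality input.

## References

* [DKKMO2020Rotational] H. Duminil-Copin, K. K. Kozlowski, D. Krachun, I. Manolescu,
  M. Oulamara, *Rotational invariance in critical planar lattice models*, arXiv:2012.11672v1
  (2020), Thm. 2.1 p. 7, §2.1 p. 7 (`𝕃(α)` "has `e^{iα/2}ℝ` as axis of symmetry"); v2 (2026),
  §1.4 eq. (5) (weights of `𝕃(α)`), §4.2 ("by horizontal symmetry, `R` is stable by
  `α ↦ π − α`").
* [SchrammSmirnov2011] O. Schramm, S. Smirnov, Ann. Probab. 39 (2011), §1.3–1.4 (the space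
  `ℋ_D`, motions of configurations).
-/

noncomputable section

open Set Filter
open _root_.MeasureTheory _root_.Topology
open scoped ENNReal Real
open Literature.Probability.LatticeModels

namespace Literature.Probability.Percolation

open QuadCrossing RandomPlanarGeometry

/-! ### The reflection `S_0` realises `swapSite` between `𝕃(α)` and `𝕃(π − α)` -/

/-- `S_0 = lineReflection 0` is the complex conjugation. [folklore] -/
theorem lineReflection_zero_apply (z : ℂ) : lineReflection 0 z = (starRingEnd ℂ) z := by
  rw [lineReflection_apply, mul_zero, Circle.exp_zero, Circle.coe_one, one_mul]

/-- `S_0` commutes with real dilations. [folklore] -/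
theorem lineReflection_zero_real_mul (δ : ℝ) (z : ℂ) :
    lineReflection 0 ((δ : ℂ) * z) = (δ : ℂ) * lineReflection 0 z := by
  rw [lineReflection_zero_apply, lineReflection_zero_apply, map_mul, Complex.conj_ofReal]

/-- `S_0` (a real-linear map) carries segments onto segments. [folklore] -/
theorem image_lineReflection_segment (β : ℝ) (a b : ℂ) :
    lineReflection β '' segment ℝ a b = segment ℝ (lineReflection β a) (lineReflection β b) := by
  have h := image_segment ℝ ((lineReflection β).toLinearEquiv.toLinearMap.toAffineMap) a b
  simpa using h

/-- **`S_0(𝕃(α)) = 𝕃(π − α)` on lattice points, through `swapSite`**: DKKMO's position of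
`𝕃(π − α)` at the site `swapSite x = (-x₁, -x₀)` is the mirror image in the real axis of the
position of `𝕃(α)` at `x` (`𝕃(α)` is the `2cos(α/2) × 2sin(α/2)` rectangular lattice rotated by
`α/2`, so `𝕃(π − α)` is its reflection with the two edge families exchanged).
[cite: DKKMO2020Rotational, §2.1 p. 7] -/
theorem isoRectDrawing_pi_sub_swapSite (α : ℝ) (x : Site 2) :
    isoRectDrawing (π - α) (swapSite x) = lineReflection 0 (isoRectDrawing α x) := by
  rw [isoRectDrawing_eq_isoRectLinear, isoRectDrawing_eq_isoRectLinear, toComplex_swapSite,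
    isoRectLinear_pi_sub_swap]

/-- Membership of a pair in the `swapSite`-image of a configuration. [folklore] -/
theorem mk_mem_image_swapPerm_iff {ω : BondConfig (Site 2)} {x y : Site 2} :
    s(x, y) ∈ (swapPerm '' ω : Set (Sym2 (Site 2))) ↔ s(swapSite x, swapSite y) ∈ ω := by
  constructor
  · rintro ⟨e, he, hex⟩
    have h2 : swapPerm (s(x, y)) = e := by
      rw [← hex]; exact isLatticeReflection_swapSite.map_map e
    rw [← h2] at he
    simpa only [coe_swapPerm, Sym2.map_mk] using he
  · intro h
    refine ⟨s(swapSite x, swapSite y), h, ?_⟩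
    simp only [coe_swapPerm, Sym2.map_mk, swapSite_involutive x, swapSite_involutive y]

/-- `swapSite` preserves the edge set of `ℤ²`, so it commutes with the restriction of a
configuration to the lattice edges. [folklore] -/
theorem image_swapPerm_inter_edgeSet (ω : BondConfig (Site 2)) :
    (swapPerm '' ω) ∩ (zdGraph 2).edgeSet = swapPerm '' (ω ∩ (zdGraph 2).edgeSet) := by
  ext e
  constructor
  · rintro ⟨⟨e', he', rfl⟩, hE⟩
    refine ⟨e', ⟨he', ?_⟩, rfl⟩
    exact isLatticeReflection_swapSite.map_mem_edgeSet_iff.1 (by simpa only [coe_swapPerm] using hE)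
  · rintro ⟨e', ⟨he', hE⟩, rfl⟩
    refine ⟨⟨e', he', rfl⟩, ?_⟩
    simpa only [coe_swapPerm] using isLatticeReflection_swapSite.map_mem_edgeSet hE

/-- **The drawn open edges transform by `S_0`.** The open edges of `swapSite(ω)` drawn at mesh
`δ` on `𝕃(π − α)` are the mirror image in the real axis of the open edges of `ω` drawn at mesh
`δ` on `𝕃(α)`. [cite: DKKMO2020Rotational, §2.1 p. 7] -/
theorem openEdgeRealization_isoRectDrawing_pi_sub_image_swapPerm (α δ : ℝ)
    (ω : BondConfig (Site 2)) :
    openEdgeRealization (isoRectDrawing (π - α)) δ (swapPerm '' ω) =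
      lineReflection 0 '' openEdgeRealization (isoRectDrawing α) δ ω := by
  ext w
  simp only [openEdgeRealization, mem_setOf_eq, mk_mem_image_swapPerm_iff]
  simp only [mem_image, mem_setOf_eq]
  constructor
  · rintro ⟨x, y, hxy, hw⟩
    refine ⟨lineReflection 0 w, ⟨swapSite x, swapSite y, hxy, ?_⟩,
      lineReflection_lineReflection 0 w⟩
    have hx : isoRectDrawing (π - α) x = lineReflection 0 (isoRectDrawing α (swapSite x)) := by
      conv_lhs => rw [← swapSite_involutive x]
      exact isoRectDrawing_pi_sub_swapSite α (swapSite x)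
    have hy : isoRectDrawing (π - α) y = lineReflection 0 (isoRectDrawing α (swapSite y)) := by
      conv_lhs => rw [← swapSite_involutive y]
      exact isoRectDrawing_pi_sub_swapSite α (swapSite y)
    rw [hx, hy, ← lineReflection_zero_real_mul, ← lineReflection_zero_real_mul,
      ← image_lineReflection_segment] at hw
    obtain ⟨w₀, hw₀, rfl⟩ := hw
    rwa [lineReflection_lineReflection]
  · rintro ⟨w₀, ⟨x, y, hxy, hw₀⟩, rfl⟩
    refine ⟨swapSite x, swapSite y, ?_, ?_⟩
    · simpa only [swapSite_involutive x, swapSite_involutive y] using hxy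
    · rw [isoRectDrawing_pi_sub_swapSite, isoRectDrawing_pi_sub_swapSite,
        ← lineReflection_zero_real_mul, ← lineReflection_zero_real_mul,
        ← image_lineReflection_segment]
      exact mem_image_of_mem _ hw₀

/-- **`S^{π−α}_{δ}(swapSite ω) = S_0 · S^{α}_{δ}(ω)` in `ℋ_ℂ`.** The configuration `swapSite(ω)`
drawn on `δ𝕃(π − α)`, read in Schramm–Smirnov's space, is the mirror image
(`QuadConfig.mapHomeomorph S_0`: `Q ↦ S_0 ∘ Q` on the crossed quads) of `ω` drawn on `δ𝕃(α)`
(transport of `S_ω` along a plane homeomorphism, `configOf_eq_mapHomeomorph`).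
[cite: DKKMO2020Rotational, §2.1 p. 7 and §1.2 p. 4] -/
theorem isoRectQuadConfig_pi_sub_image_swapPerm (α δ : ℝ) (ω : BondConfig (Site 2)) :
    isoRectQuadConfig (π - α) δ (swapPerm '' ω) =
      (isoRectQuadConfig α δ ω).mapHomeomorph (lineReflection 0).toHomeomorph := by
  unfold isoRectQuadConfig
  rw [image_swapPerm_inter_edgeSet]
  exact configOf_eq_mapHomeomorph (lineReflection 0).toHomeomorph
    (openEdgeRealization_isoRectDrawing_pi_sub_image_swapPerm α δ _)

/-- At the self-dual angle: `S^{π/2}_{δ}(swapSite ω) = S_0 · S^{π/2}_{δ}(ω)` (`π − π/2 = π/2`).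
[cite: DKKMO2020Rotational, §2.1 p. 7] -/
theorem isoRectQuadConfig_pi_div_two_image_swapPerm (δ : ℝ) (ω : BondConfig (Site 2)) :
    isoRectQuadConfig (π / 2) δ (swapPerm '' ω) =
      (isoRectQuadConfig (π / 2) δ ω).mapHomeomorph (lineReflection 0).toHomeomorph := by
  have h := isoRectQuadConfig_pi_sub_image_swapPerm (π / 2) δ ω
  rwa [show π - π / 2 = π / 2 by ring] at h

/-! ### `swapSite` carries `φ_{δ𝕃(α)}` to `φ_{δ𝕃(π−α)}` -/

/-- **The law transforms accordingly**: the image of `φ_{𝕃(α)} = prodBernoulli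
(isoRectCriticalProb α)` under `ω ↦ swapSite(ω)` is `φ_{𝕃(π−α)}` (the weights of `𝕃(π − α)`
are those of `𝕃(α)` with the horizontal and vertical edges exchanged;
`isoRectPercolation_map_swapSite_pi_sub` through `prodBernoulli_isoRectCriticalProb`).
[cite: DKKMO2020Rotational, §2.2 p. 7] -/
theorem prodBernoulli_isoRectCriticalProb_map_image_swapPerm (α : ℝ) :
    (prodBernoulli (isoRectCriticalProb α)).map (fun ω => swapPerm '' ω) =
      prodBernoulli (isoRectCriticalProb (π - α)) := by
  rw [prodBernoulli_isoRectCriticalProb, prodBernoulli_isoRectCriticalProb,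
    isoRectPercolation_map_swapSite_pi_sub]

/-- `φ_{𝕃(π/2)}` (critical bond percolation on `ℤ²`) is `swapSite`-invariant.
[cite: DKKMO2020Rotational, §2.1 p. 7] -/
theorem prodBernoulli_isoRectCriticalProb_pi_div_two_map_image_swapPerm :
    (prodBernoulli (isoRectCriticalProb (π / 2))).map (fun ω => swapPerm '' ω) =
      prodBernoulli (isoRectCriticalProb (π / 2)) := by
  have h := prodBernoulli_isoRectCriticalProb_map_image_swapPerm (π / 2)
  rwa [show π - π / 2 = π / 2 by ring] at h

/-! ### Transport of couplings and the reduction to acute angles -/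

/-- **Push-forward of a coupling under `swapSite × swapSite`.** A coupling `P` of `φ_{δ𝕃(α)}`
and `φ_{δ𝕃(π/2)}` charging an event `A` with probability `< η` yields the coupling
`(swapSite × swapSite)_* P` of `φ_{δ𝕃(π−α)}` and `φ_{δ𝕃(π/2)}`
(`prodBernoulli_isoRectCriticalProb_map_image_swapPerm`, and `φ_{δ𝕃(π/2)}` is invariant), which
charges every event `B` whose preimage lies in `A` with probability `< η`
(`swapSite × swapSite` is a measurable automorphism, so this holds for all `B`, measurable or
not). (DKKMO, v2 §4.2: "by horizontal symmetry, `R` is stable by `α ↦ π − α`".)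
[cite: DKKMO2020Rotational, Thm. 2.1 (d_SS part)] -/
theorem coupling_image_swapPerm {α : ℝ} {η : ℝ≥0∞}
    {A B : Set (BondConfig (Site 2) × BondConfig (Site 2))}
    (hAB : ∀ p : BondConfig (Site 2) × BondConfig (Site 2), (swapPerm '' p.1, swapPerm '' p.2) ∈ B → p ∈ A)
    (h : ∃ P : Measure (BondConfig (Site 2) × BondConfig (Site 2)),
      P.map Prod.fst = prodBernoulli (isoRectCriticalProb α) ∧
      P.map Prod.snd = prodBernoulli (isoRectCriticalProb (π / 2)) ∧ P A < η) :
    ∃ P : Measure (BondConfig (Site 2) × BondConfig (Site 2)),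
      P.map Prod.fst = prodBernoulli (isoRectCriticalProb (π - α)) ∧
      P.map Prod.snd = prodBernoulli (isoRectCriticalProb (π / 2)) ∧ P B < η := by
  obtain ⟨P, h₁, h₂, hP⟩ := h
  -- `swapSite × swapSite` as a measurable automorphism of pairs of configurations
  let ρ : BondConfig (Site 2) ≃ᵐ BondConfig (Site 2) :=
    ⟨Equiv.Set.congr swapPerm, measurable_image_equiv _, measurable_image_equiv _⟩
  let e : BondConfig (Site 2) × BondConfig (Site 2) ≃ᵐ BondConfig (Site 2) × BondConfig (Site 2) :=
    MeasurableEquiv.prodCongr ρ ρ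
  refine ⟨P.map e, ?_, ?_, ?_⟩
  · rw [Measure.map_map measurable_fst e.measurable]
    have : Prod.fst ∘ ⇑e = (fun ω : BondConfig (Site 2) => swapPerm '' ω) ∘ Prod.fst := rfl
    rw [this, ← Measure.map_map (measurable_image_equiv swapPerm) measurable_fst, h₁,
      prodBernoulli_isoRectCriticalProb_map_image_swapPerm]
  · rw [Measure.map_map measurable_snd e.measurable]
    have : Prod.snd ∘ ⇑e = (fun ω : BondConfig (Site 2) => swapPerm '' ω) ∘ Prod.snd := rfl
    rw [this, ← Measure.map_map (measurable_image_equiv swapPerm) measurable_snd, h₂,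
      prodBernoulli_isoRectCriticalProb_pi_div_two_map_image_swapPerm]
  · rw [MeasurableEquiv.map_apply]
    exact lt_of_le_of_lt (measure_mono fun p hp => hAB p hp) hP

/-- **Horizontal symmetry of the `d_SS` couplings.** Let `N` be any set of pairs of
configurations of `ℋ_ℂ` and `N' = (S_0 × S_0)⁻¹ N` its mirror image. If some coupling of
`φ_{δ𝕃(α)}` and `φ_{δ𝕃(π/2)}` keeps `(S^{α}_{ω}, S^{π/2}_{ω'})` in `N'` off an event of
probability `< η`, then its push-forward under `swapSite × swapSite` is a coupling of
`φ_{δ𝕃(π−α)}` and `φ_{δ𝕃(π/2)}` keeping `(S^{π−α}, S^{π/2})` in `N` off an event of probability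
`< η` (`isoRectQuadConfig_pi_sub_image_swapPerm`; DKKMO, v2 §4.2: "by horizontal symmetry, `R`
is stable by `α ↦ π − α`", here for the Schramm–Smirnov distance).
[cite: DKKMO2020Rotational, Thm. 2.1 (d_SS part)] -/
theorem DKKMO2020_thm21_schrammSmirnov.coupling_pi_sub {α δ : ℝ} {η : ℝ≥0∞}
    {N : Set (QuadConfig (univ : Set ℂ) × QuadConfig (univ : Set ℂ))}
    (h : ∃ P : Measure (BondConfig (Site 2) × BondConfig (Site 2)),
      P.map Prod.fst = prodBernoulli (isoRectCriticalProb α) ∧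
      P.map Prod.snd = prodBernoulli (isoRectCriticalProb (π / 2)) ∧
      P {p | ((isoRectQuadConfig α δ p.1).mapHomeomorph (lineReflection 0).toHomeomorph,
          (isoRectQuadConfig (π / 2) δ p.2).mapHomeomorph (lineReflection 0).toHomeomorph) ∉ N} <
        η) :
    ∃ P : Measure (BondConfig (Site 2) × BondConfig (Site 2)),
      P.map Prod.fst = prodBernoulli (isoRectCriticalProb (π - α)) ∧
      P.map Prod.snd = prodBernoulli (isoRectCriticalProb (π / 2)) ∧
      P {p | (isoRectQuadConfig (π - α) δ p.1, isoRectQuadConfig (π / 2) δ p.2) ∉ N} < η := by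
  refine coupling_image_swapPerm (fun p hp => ?_) h
  have hp' : (isoRectQuadConfig (π - α) δ (swapPerm '' p.1),
      isoRectQuadConfig (π / 2) δ (swapPerm '' p.2)) ∉ N := hp
  rwa [isoRectQuadConfig_pi_sub_image_swapPerm, isoRectQuadConfig_pi_div_two_image_swapPerm]
    at hp'

/-- **Horizontal symmetry of couplings agreeing on finitely many quads.** If some coupling of
`φ_{δ𝕃(α)}` and `φ_{δ𝕃(π/2)}` makes the crossing indicators of every mirrored quad `S_0⁻¹ ∘ Q`,
`Q ∈ F`, agree in `S^{α}_{ω}` and `S^{π/2}_{ω'}` off an event of probability `< η`, then its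
push-forward under `swapSite × swapSite` is a coupling of `φ_{δ𝕃(π−α)}` and `φ_{δ𝕃(π/2)}` making
the crossing indicators of every `Q ∈ F` agree in `S^{π−α}` and `S^{π/2}` off probability `< η`
(`Q ∈ S_0 · S ↔ S_0⁻¹ ∘ Q ∈ S`, `QuadConfig.mem_mapHomeomorph`).
[cite: DKKMO2020Rotational, Thm. 2.1 (d_SS part)] -/
theorem finiteQuads_coupling_pi_sub {α δ : ℝ} {η : ℝ≥0∞} (F : Finset (Quad (univ : Set ℂ)))
    (h : ∃ P : Measure (BondConfig (Site 2) × BondConfig (Site 2)),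
      P.map Prod.fst = prodBernoulli (isoRectCriticalProb α) ∧
      P.map Prod.snd = prodBernoulli (isoRectCriticalProb (π / 2)) ∧
      P {p | ∃ Q ∈ F,
        ¬ (Q.mapHomeomorph (lineReflection 0).toHomeomorph.symm ∈ isoRectQuadConfig α δ p.1 ↔
          Q.mapHomeomorph (lineReflection 0).toHomeomorph.symm ∈
            isoRectQuadConfig (π / 2) δ p.2)} < η) :
    ∃ P : Measure (BondConfig (Site 2) × BondConfig (Site 2)),
      P.map Prod.fst = prodBernoulli (isoRectCriticalProb (π - α)) ∧
      P.map Prod.snd = prodBernoulli (isoRectCriticalProb (π / 2)) ∧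
      P {p | ∃ Q ∈ F, ¬ (Q ∈ isoRectQuadConfig (π - α) δ p.1 ↔
        Q ∈ isoRectQuadConfig (π / 2) δ p.2)} < η := by
  refine coupling_image_swapPerm (fun p hp => ?_) h
  obtain ⟨Q, hQF, hQ⟩ : ∃ Q ∈ F, ¬ (Q ∈ isoRectQuadConfig (π - α) δ (swapPerm '' p.1) ↔
      Q ∈ isoRectQuadConfig (π / 2) δ (swapPerm '' p.2)) := hp
  refine ⟨Q, hQF, ?_⟩
  rwa [isoRectQuadConfig_pi_sub_image_swapPerm, isoRectQuadConfig_pi_div_two_image_swapPerm,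
    QuadConfig.mem_mapHomeomorph, QuadConfig.mem_mapHomeomorph] at hQ

/-- **DKKMO's `d_SS` statement among the rectangular lattices reduces to the acute angles**:
`DKKMO2020_thm21_schrammSmirnov` holds iff for every `ε > 0` and every open neighbourhood `N` of
the diagonal of `ℋ_ℂ × ℋ_ℂ` there is `δ₀ > 0` such that for `α ∈ (ε, π/2]` and `0 < δ ≤ δ₀` some
coupling of `φ_{δ𝕃(α)}` and `φ_{δ𝕃(π/2)}` keeps `(S^{α}_{ω}, S^{π/2}_{ω'})` in `N` off an event of
probability `< ε`. The obtuse angles `α ∈ (π/2, π − ε)` follow from the hypothesis at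
`π − α ∈ (ε, π/2)` applied to the mirrored neighbourhood `(S_0 × S_0)⁻¹ N` (open, by
`QuadConfig.continuous_mapHomeomorph`, and containing the diagonal) and the horizontal symmetry
`DKKMO2020_thm21_schrammSmirnov.coupling_pi_sub`. (DKKMO, v2 §4.2, "by horizontal symmetry,
`R` is stable by `α ↦ π − α`" — on the Schramm–Smirnov side.)
[cite: DKKMO2020Rotational, Thm. 2.1 (d_SS part)] -/
theorem DKKMO2020_thm21_schrammSmirnov_iff_le_pi_div_two :
    DKKMO2020_thm21_schrammSmirnov ↔
      ∀ ε : ℝ, 0 < ε →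
        ∀ N : Set (QuadConfig (univ : Set ℂ) × QuadConfig (univ : Set ℂ)), IsOpen N →
          (∀ S, (S, S) ∈ N) →
          ∃ δ₀ : ℝ, 0 < δ₀ ∧ ∀ α ∈ Set.Ioc ε (π / 2), ∀ δ : ℝ, 0 < δ → δ ≤ δ₀ →
            ∃ P : Measure (BondConfig (Site 2) × BondConfig (Site 2)),
              P.map Prod.fst = prodBernoulli (isoRectCriticalProb α) ∧
              P.map Prod.snd = prodBernoulli (isoRectCriticalProb (π / 2)) ∧
              P {p | (isoRectQuadConfig α δ p.1, isoRectQuadConfig (π / 2) δ p.2) ∉ N} <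
                ENNReal.ofReal ε := by
  constructor
  · intro h ε hε N hN hdiag
    obtain ⟨δ₀, hδ₀, H⟩ := h ε hε N hN hdiag
    -- `ε < α ≤ π/2` gives `α < π - ε`
    exact ⟨δ₀, hδ₀, fun α hα δ hδ hδ₀' => H α ⟨hα.1, by linarith [hα.1, hα.2]⟩ δ hδ hδ₀'⟩
  · intro h ε hε N hN hdiag
    -- the mirrored neighbourhood `(S_0 × S_0)⁻¹ N`
    have hN'open : IsOpen {q : QuadConfig (univ : Set ℂ) × QuadConfig (univ : Set ℂ) |
        (q.1.mapHomeomorph (lineReflection 0).toHomeomorph,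
          q.2.mapHomeomorph (lineReflection 0).toHomeomorph) ∈ N} :=
      hN.preimage ((QuadConfig.continuous_mapHomeomorph (lineReflection 0).toHomeomorph).prodMap
        (QuadConfig.continuous_mapHomeomorph (lineReflection 0).toHomeomorph))
    obtain ⟨δ₁, hδ₁, H₁⟩ := h ε hε N hN hdiag
    obtain ⟨δ₂, hδ₂, H₂⟩ := h ε hε _ hN'open fun S => hdiag _
    refine ⟨min δ₁ δ₂, lt_min hδ₁ hδ₂, fun α hα δ hδ hδ₀ => ?_⟩
    rcases le_or_gt α (π / 2) with hle | hgt
    · exact H₁ α ⟨hα.1, hle⟩ δ hδ (hδ₀.trans (min_le_left _ _))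
    · -- obtuse angle: couple at `π - α ∈ (ε, π/2)` inside `N'` and reflect
      have hβ : π - α ∈ Set.Ioc ε (π / 2) := ⟨by linarith [hα.2], by linarith⟩
      have hcpl := H₂ (π - α) hβ δ hδ (hδ₀.trans (min_le_right _ _))
      have := DKKMO2020_thm21_schrammSmirnov.coupling_pi_sub (N := N) (α := π - α) (δ := δ)
        (η := ENNReal.ofReal ε) hcpl
      rwa [sub_sub_cancel] at this

/-- **The weakest interface: finitely many quads, acute angles.**
`DKKMO2020_thm21_schrammSmirnov` holds iff for every `ε > 0` and every finite family `F` of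
quads there is `δ₀ > 0` such that for every ACUTE `α ∈ (ε, π/2]` and `0 < δ ≤ δ₀` some coupling
of `φ_{δ𝕃(α)}` and `φ_{δ𝕃(π/2)}` makes all the crossing indicators of `F` in `S^{α}_{ω}` and
`S^{π/2}_{ω'}` agree outside an event of probability `< ε`. Forward: the reduction to finitely
many quads (`DKKMO2020_thm21_schrammSmirnov_iff_finiteQuads`, which rests on Schramm–Smirnov's
Lemma 5.1, discharged in the tree). Backward: for an obtuse `α ∈ (π/2, π − ε)` apply the
hypothesis at `π − α` to the mirrored family `{S_0⁻¹ ∘ Q : Q ∈ F}` and push the coupling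
forward by `swapSite × swapSite` (`finiteQuads_coupling_pi_sub`), then conclude by the same
reduction. (DKKMO, v2 §4.2, horizontal symmetry; v1 Thm. 2.1.)
[cite: DKKMO2020Rotational, Thm. 2.1 (d_SS part)] -/
theorem DKKMO2020_thm21_schrammSmirnov_iff_finiteQuads_le_pi_div_two :
    DKKMO2020_thm21_schrammSmirnov ↔
      ∀ ε : ℝ, 0 < ε → ∀ F : Finset (Quad (univ : Set ℂ)),
        ∃ δ₀ : ℝ, 0 < δ₀ ∧ ∀ α ∈ Set.Ioc ε (π / 2), ∀ δ : ℝ, 0 < δ → δ ≤ δ₀ →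
          ∃ P : Measure (BondConfig (Site 2) × BondConfig (Site 2)),
            P.map Prod.fst = prodBernoulli (isoRectCriticalProb α) ∧
            P.map Prod.snd = prodBernoulli (isoRectCriticalProb (π / 2)) ∧
            P {p | ∃ Q ∈ F, ¬ (Q ∈ isoRectQuadConfig α δ p.1 ↔
              Q ∈ isoRectQuadConfig (π / 2) δ p.2)} < ENNReal.ofReal ε := by
  classical
  constructor
  · intro h ε hε F
    obtain ⟨δ₀, hδ₀, H⟩ := DKKMO2020_thm21_schrammSmirnov_iff_finiteQuads.1 h ε hε F
    exact ⟨δ₀, hδ₀, fun α hα δ hδ hδ₀' => H α ⟨hα.1, by linarith [hα.1, hα.2]⟩ δ hδ hδ₀'⟩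
  · intro h
    refine DKKMO2020_thm21_schrammSmirnov_iff_finiteQuads.2 fun ε hε F => ?_
    obtain ⟨δ₁, hδ₁, H₁⟩ := h ε hε F
    obtain ⟨δ₂, hδ₂, H₂⟩ :=
      h ε hε (F.image fun Q => Q.mapHomeomorph (lineReflection 0).toHomeomorph.symm)
    refine ⟨min δ₁ δ₂, lt_min hδ₁ hδ₂, fun α hα δ hδ hδ₀ => ?_⟩
    rcases le_or_gt α (π / 2) with hle | hgt
    · exact H₁ α ⟨hα.1, hle⟩ δ hδ (hδ₀.trans (min_le_left _ _))
    · -- obtuse angle: couple at `π - α ∈ (ε, π/2)` on the mirrored family and reflect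
      have hβ : π - α ∈ Set.Ioc ε (π / 2) := ⟨by linarith [hα.2], by linarith⟩
      obtain ⟨P, hP₁, hP₂, hP⟩ := H₂ (π - α) hβ δ hδ (hδ₀.trans (min_le_right _ _))
      have hcpl := finiteQuads_coupling_pi_sub (α := π - α) (δ := δ) (η := ENNReal.ofReal ε) F
        ⟨P, hP₁, hP₂, lt_of_le_of_lt (measure_mono fun p hp => ?_) hP⟩
      · rwa [sub_sub_cancel] at hcpl
      · obtain ⟨Q, hQF, hQ⟩ := hp
        exact ⟨_, Finset.mem_image_of_mem _ hQF, hQ⟩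

end Literature.Probability.Percolation

end
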